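import Literature.NumberTheory.Transcendental.KZProductIdeal
import Literature.NumberTheory.Transcendental.KZLogCalculusProofs

/-!
# `CubeKernelStep` (stmt-KontsevichZagierPeriods-17854), line `Sketch`, stub `stub_separatedRankOne`

THE SEPARATED RANK-ONE RUNG of the crux `CubeKernelStep` (route UnfoldedStokes): under the lower
layers `K(≤d)` (every continuous closed-cube representation of dimension `≤ d` with value `0` is a
Kontsevich–Zagier relation), a closed `(d+1)`-cube representation `t` whose integrand is, on the
cube, the separated product `b(init z) · a(z last)` of the continuous integrands of a closed
`1`-cube representation `A` and a closed `d`-cube representation `B`, and whose value is `0`, is a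
relation.

Proof. (i) `t` is congruent modulo `KZ.relations` to the product representation `B.prod A`
(`KZProduct.lean`): both live on the closed `(d+1)`-cube (`prodDomain` of two cubes is the cube)
and their integrands agree there (`IntegralRep.prod_integrand_eq`, `prodFun_apply`; `Fin.init`
is restriction to the first `d` coordinates and `Fin.natAdd d (0 : Fin 1) = Fin.last d`), so
`[t] − [B.prod A] ∈ relations` by the congruence lemma `KZ.of_sub_of_mem_relations_of_eqOn`.
(ii) By soundness (`Equivalent.value_eq_holds`) and Fubini (`IntegralRep.value_prod`),
`0 = t.value = B.value · A.value`, so `B.value = 0` or `A.value = 0`. (iii) In the first case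
`K(≤d)` at `M = d` kills `[B]` and the right ideal property (`mul_mem_relations_right_holds`) kills
`[B] · [A]`; in the second `K(≤d)` at `M = 1 ≤ d` kills `[A]` and the left ideal property
(`mul_mem_relations_left_holds`) kills `[B] · [A]`. (iv) `[B] · [A] = [B.prod A]` (`of_mul_of`),
and `[t] = ([t] − [B.prod A]) + [B.prod A]`.

References: M. Kontsevich, D. Zagier, *Periods* (2001), §1.2 (rules), §4.1 (p. 31, products by
Fubini).
-/

noncomputable section

set_option linter.dupNamespace false

namespace Summit.KontsevichZagierPeriods.KontsevichZagierPeriods.Cruxes.CubeKernelStep.Layers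

open MeasureTheory Set
open Literature.NumberTheory.Transcendental
open Literature.NumberTheory.Transcendental.KZ

/-- The product domain of the closed `d`-cube with the closed `1`-cube is the closed
`(d+1)`-cube. [folklore] -/
theorem prod_domain_cube_eq_cube {d : ℕ} (A : IntegralRep 1) (B : IntegralRep d)
    (hA : A.domain = Set.pi Set.univ (fun _ : Fin 1 => Set.Icc (0:ℝ) 1))
    (hB : B.domain = Set.pi Set.univ (fun _ : Fin d => Set.Icc (0:ℝ) 1)) :
    (B.prod A).domain = Set.pi Set.univ (fun _ : Fin (d + 1) => Set.Icc (0:ℝ) 1) := by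
  ext z
  simp only [IntegralRep.prod_domain, IntegralRep.mem_prodDomain, hA, hB, Set.mem_univ_pi]
  constructor
  · rintro ⟨h1, h2⟩ i
    induction i using Fin.addCases with
    | left j => exact h1 j
    | right k => exact h2 k
  · intro h
    exact ⟨fun j => h _, fun k => h _⟩

/-- On `Fin 1` the trailing-coordinate embedding `Fin.natAdd d` is the constant `Fin.last d`.
[folklore] -/
theorem natAdd_fin_one_eq_last (d : ℕ) (j : Fin 1) : Fin.natAdd d j = Fin.last d := by
  ext
  simp only [Fin.val_natAdd, Fin.val_last, Fin.val_eq_zero j, add_zero]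

/-- The separated product `b(init z) · a(z last)` is the product function `prodFun B A` of
`KZProduct.lean`. [cite: KontsevichZagier2001, §4.1] -/
theorem prodFun_eq_init_mul_last {d : ℕ} (A : IntegralRep 1) (B : IntegralRep d)
    (z : Fin (d + 1) → ℝ) :
    IntegralRep.prodFun B A z =
      B.integrand (Fin.init z) * A.integrand (fun _ : Fin 1 => z (Fin.last d)) := by
  rw [IntegralRep.prodFun_apply]
  have h2 : (fun j : Fin 1 => z (Fin.natAdd d j)) = fun _ : Fin 1 => z (Fin.last d) := by
    funext j
    rw [natAdd_fin_one_eq_last d j]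
  rw [h2]
  rfl

/-- RUNG (separated rank one) of the crux `CubeKernelStep`: under `K(≤d)` (`d ≥ 1`), a closed
`(d+1)`-cube representation of value `0` whose integrand is the separated product
`b(init z) · a(z last)` of the continuous integrands of a closed `1`-cube representation `A` and a
closed `d`-cube representation `B` is a Kontsevich–Zagier relation: congruence with `B.prod A`,
Fubini `value (B.prod A) = B.value · A.value = 0`, `K(≤d)` on the vanishing factor, and the
two-sided ideal property of `relations`. [cite: KontsevichZagier2001, §4.1] -/
theorem stub_separatedRankOne :
    ∀ d : ℕ, 1 ≤ d →
      (∀ (M : ℕ), M ≤ d → ∀ (a : IntegralRep M),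
        a.domain = Set.pi Set.univ (fun _ : Fin M => Set.Icc (0:ℝ) 1) →
        ContinuousOn a.integrand a.domain → a.value = 0 → of a ∈ relations) →
      ∀ (t : IntegralRep (d + 1)) (A : IntegralRep 1) (B : IntegralRep d),
        t.domain = Set.pi Set.univ (fun _ : Fin (d + 1) => Set.Icc (0:ℝ) 1) →
        A.domain = Set.pi Set.univ (fun _ : Fin 1 => Set.Icc (0:ℝ) 1) →
        B.domain = Set.pi Set.univ (fun _ : Fin d => Set.Icc (0:ℝ) 1) →
        ContinuousOn A.integrand A.domain → ContinuousOn B.integrand B.domain →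
        Set.EqOn t.integrand
          (fun z => B.integrand (Fin.init z) * A.integrand (fun _ : Fin 1 => z (Fin.last d))) t.domain →
        t.value = 0 → of t ∈ relations := by
  intro d hd hK t A B ht hA hB hAc hBc heq hval
  -- (i) congruence with the product representation `B.prod A`
  have hdom : (B.prod A).domain = t.domain := by
    rw [ht]
    exact prod_domain_cube_eq_cube A B hA hB
  have hint : Set.EqOn t.integrand (B.prod A).integrand t.domain := by
    intro z hz
    rw [heq hz, IntegralRep.prod_integrand_eq, prodFun_eq_init_mul_last]
  have hcong : of t - of (B.prod A) ∈ relations := of_sub_of_mem_relations_of_eqOn hdom hint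
  -- (ii) soundness and Fubini: `B.value * A.value = 0`
  have hBA : B.value * A.value = 0 := by
    have h : t.value = (B.prod A).value := Equivalent.value_eq_holds hcong
    rw [← IntegralRep.value_prod, ← h, hval]
  -- (iii)/(iv) `K(≤d)` on the vanishing factor, then the ideal property and `of_mul_of`
  have hprod : of (B.prod A) ∈ relations := by
    rw [← of_mul_of]
    rcases mul_eq_zero.mp hBA with hB0 | hA0
    · exact mul_mem_relations_right_holds _ _ (hK d le_rfl B hB hBc hB0)
    · exact mul_mem_relations_left_holds _ _ (hK 1 hd A hA hAc hA0)
  have hsplit : of t = (of t - of (B.prod A)) + of (B.prod A) := by abel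
  rw [hsplit]
  exact relations.add_mem hcong hprod

end Summit.KontsevichZagierPeriods.KontsevichZagierPeriods.Cruxes.CubeKernelStep.Layers
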